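import Summits.RiemannHypothesis.RiemannHypothesis.Theses.SignCone
import Summits.RiemannHypothesis.RiemannHypothesis.Theorems.SignConeOscillatory.Negative.OriginDominatingCells
import Summits.RiemannHypothesis.RiemannHypothesis.Theorems.SignConeOscillatory.Negative.OriginDominatingWitness
import Literature.NumberTheory.LFunctions.WeilExplicitArchTermProofs
import Literature.NumberTheory.LFunctions.WeilMellinBounds
import Mathlib.Analysis.SpecialFunctions.ImproperIntegrals
import Mathlib.MeasureTheory.Integral.ExpDecay

/-!
# `SignConeOscillatory` (crux stmt-RiemannHypothesis-16302) — negative lemma §A′: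
# origin domination does not substitute for positive-definiteness

The disprover's documented near-miss §A′ of `Cruxes/SignConeOscillatory/Disproof.lean`
(`refuter-cdisprove-stmt-RiemannHypothesis-16302-0`, cycle 1), now kernel-checked.  The crux
`Summit.RiemannHypothesis.RiemannHypothesis.Theses.SignCone.SignConeOscillatory` asserts the unit-slack sign-cone
inequality `-Re F(0) ≤ Re W_ar(F)` for node-nonnegative, oscillatory AUTOCORRELATION SUMS `F = Σᵢ gᵢ ⋆ g̃ᵢ`,
`supp gᵢ ⊆ [-a, a]`.  `Negative/WithoutPD.lean` (p130023) showed that the cone structure cannot be weakened to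
"smooth, compactly supported in `[-2a, 2a]`, hermitian"; here we show that even adding ORIGIN DOMINATION
`‖F t‖ ≤ Re F(0)` — the cheap consequence of positive-definiteness that, together with hermitian symmetry and the
far-field sign, carries the bookkeeping proof of the sibling crux `SignConeFarField` — does not rescue it:

* `signConeOscillatory_false_without_PD_originDominating` : the mutated statement is FALSE.

Witness (`a = 11/10`): the real even plateau comb `F = β₀ - Σ_{i<4} (βᵢ(· - cᵢ) + βᵢ(· + cᵢ))`
(`OriginDominatingComb/Witness.lean`): central plateau `β₀` (`rIn = 0.28`, `rOut = 0.32`) and negative unit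
plateaus centred at `c = 0.5, 0.86, 1.48, 2.14` sitting below `log 2` and in the node gaps `(log 2, log 3)`,
`(log 4, log 5)`, `(log 8, log 9)`.  Then `F(0) = 1 ≥ |F|`, `F(log n) = 0`, `F(0.86) = -1`, and with Bombieri's
form of the archimedean term (`weilArchTermBombieri_eq_weilArchTerm_holds`)
`Re W_ar(F) + 1 = 1 - (log 4π + γ) + ∫₀^∞ D`, `D(t) = 2F(t)(e^{-t/2} + e^{t/2}) - (e^{t/2}F(t) - 1)/sinh t`;
the 23 cell bounds of `OriginDominatingCells.lean` plus the tail `t ≥ 2.18` give `∫₀^∞ D ≤ 1.624`, whence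
`Re W_ar(F) + Re F(0) ≤ -0.36 < 0`.  Reading for provers: beyond `|F| ≤ F(0)`, a proof of the crux must use the
full positive-definiteness of `F` (`F̂ ≥ 0`), exactly the input absent from the far-field bookkeeping.
-/

noncomputable section

-- `Summit.RiemannHypothesis.RiemannHypothesis.…` repeats a namespace component by design (D-0017 layout).
set_option linter.dupNamespace false

open scoped BigOperators ComplexConjugate Topology
open Complex MeasureTheory Set Filter intervalIntegral

namespace Summit.RiemannHypothesis.RiemannHypothesis.Theorems.SignConeOscillatory.Negative

open Literature.NumberTheory.LFunctions

/-- **Origin domination does not rescue §A** (`Disproof.lean` §A′): the crux `SignConeOscillatory` with its cone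
structure replaced by "`F` smooth, compactly supported in `[-2a, 2a]`, hermitian and origin-dominating
(`‖F u‖ ≤ Re F(0)`)" — node hypothesis, oscillation hypothesis and conclusion verbatim — is FALSE.  Witness: the
plateau comb of the module docstring at `a = 11/10`. -/
theorem signConeOscillatory_false_without_PD_originDominating : ¬ (∀ a : ℝ, 0 < a → ∀ F : ℝ → ℂ, (ContDiff ℝ ((⊤ : ℕ∞) : WithTop ℕ∞) F ∧ HasCompactSupport F) ∧ tsupport F ⊆ Set.Icc (-(2 * a)) (2 * a) → (∀ u : ℝ, F (-u) = (starRingEnd ℂ) (F u)) → (∀ u : ℝ, ‖F u‖ ≤ (F 0).re) → (∀ n : ℕ, 2 ≤ n → 0 ≤ (F (Real.log n)).re) → (∃ t : ℝ, Real.log 2 ≤ |t| ∧ (F t).re < 0) → let M : ℂ → ℂ := fun s => ∫ u : ℝ, F u * Complex.exp ((s - 1 / 2) * u); -(F 0).re ≤ (M 0 + M 1 + ((1 / (2 * Real.pi) : ℂ) * (∫ t : ℝ, M (1 / 2 + t * Complex.I) * ((Complex.digamma (1 / 4 + t / 2 * Complex.I)).re : ℂ)) - F 0 * (Real.log Real.pi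 : ℂ))).re) := by
  intro h
  /- ### the witness -/
  obtain ⟨b₀, hb₀⟩ : ∃ b₀ : ContDiffBump (0 : ℝ), b₀ = ⟨0.28, 0.32, by norm_num, by norm_num⟩ := ⟨_, rfl⟩
  obtain ⟨b, hb⟩ : ∃ b : Fin 4 → ContDiffBump (0 : ℝ), b =
      ![⟨0.14, 0.18, by norm_num, by norm_num⟩, ⟨0.12, 0.16, by norm_num, by norm_num⟩,
        ⟨0.06, 0.08, by norm_num, by norm_num⟩, ⟨0.02, 0.04, by norm_num, by norm_num⟩] := ⟨_, rfl⟩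
  obtain ⟨c, hc⟩ : ∃ c : Fin 4 → ℝ, c = ![0.5, 0.86, 1.48, 2.14] := ⟨_, rfl⟩
  obtain ⟨f, hf⟩ : ∃ f : ℝ → ℝ, f = fun u => b₀ u - ∑ i, (b i (u - c i) + b i (u + c i)) := ⟨_, rfl⟩
  obtain ⟨F, hFdef⟩ : ∃ F : ℝ → ℂ, F = fun u => ((f u : ℝ) : ℂ) := ⟨_, rfl⟩
  have hb₀in : b₀.rIn = 0.28 := by rw [hb₀]
  have hb₀out : b₀.rOut = 0.32 := by rw [hb₀]
  have hbin : ∀ i, (b i).rIn = (![0.14, 0.12, 0.06, 0.02] : Fin 4 → ℝ) i := by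
    intro i; rw [hb]; fin_cases i <;> rfl
  have hbout : ∀ i, (b i).rOut = (![0.18, 0.16, 0.08, 0.04] : Fin 4 → ℝ) i := by
    intro i; rw [hb]; fin_cases i <;> rfl
  have W_far := w_far hb₀out hbout hc
  have W_sep := w_sep hbout hc
  have W_pos1 := w_pos1 hb₀in hbout hc hf
  have W_possh := w_possh hbout hc hf
  have W_nonpos := w_nonpos hb₀out hbout hc hf
  have W_plateau := w_plateau hb₀out hbin hbout hc hf
  /- ### structural properties -/
  have hfs : ContDiff ℝ ((⊤ : ℕ∞) : WithTop ℕ∞) f := comb_contDiff hf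
  have hfc : HasCompactSupport f := comb_hasCompactSupport hf
  have hFtest : IsWeilTest F := by
    rw [hFdef]; exact ⟨ofRealCLM.contDiff.comp hfs, hfc.comp_left Complex.ofReal_zero⟩
  have hFapp : ∀ u, F u = ((f u : ℝ) : ℂ) := fun u => by rw [hFdef]
  have hf0 : f 0 = 1 := w_zero hb₀in hbout hc hf
  have hF0 : F 0 = 1 := by rw [hFapp, hf0]; simp
  have hzeroR : ∀ u, 2.18 ≤ |u| → f u = 0 := fun u hu => w_zeroR hb₀out hbout hc hf hu
  have hsupp : tsupport F ⊆ Set.Icc (-(2 * (11 / 10 : ℝ))) (2 * (11 / 10)) := by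
    refine closure_minimal (fun u hu => ?_) isClosed_Icc
    rw [Function.mem_support, hFapp] at hu
    have hu' : f u ≠ 0 := fun h0 => hu (by simp [h0])
    by_contra habs
    refine hu' (hzeroR u ?_)
    rw [mem_Icc, not_and_or, not_le, not_le] at habs
    rcases habs with h' | h'
    · linarith [neg_le_abs u]
    · linarith [le_abs_self u]
  have hfeven : ∀ u, f (-u) = f u := comb_neg hf
  have heven : ∀ u, F (-u) = F u := fun u => by rw [hFapp, hFapp, hfeven u]
  have hherm : ∀ u : ℝ, F (-u) = (starRingEnd ℂ) (F u) := fun u => by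
    rw [heven, hFapp, Complex.conj_ofReal]
  have hdom : ∀ u : ℝ, ‖F u‖ ≤ (F 0).re := fun u => by
    rw [hF0, Complex.one_re, hFapp, Complex.norm_real, Real.norm_eq_abs]
    exact comb_abs_le_one hf W_far W_sep u
  have hnodes : ∀ n : ℕ, 2 ≤ n → 0 ≤ (F (Real.log n)).re := fun n hn => by
    -- `1.6 < log 5` (`e^{0.8} ≤ 2.2255410`, squared `< 5`; the tree's `Dioph.log_five_gt_d1`, inlined to keep imports light)
    have hlog5 : (1.6 : ℝ) < Real.log 5 := by
      rw [Real.lt_log_iff_exp_lt (by norm_num)]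
      have hx0 : (0 : ℝ) ≤ 0.8 := by norm_num
      have hx1 : (0.8 : ℝ) ≤ 1 := by norm_num
      have hu := Real.exp_bound' hx0 hx1 (n := 12) (by norm_num)
      simp only [Finset.sum_range_succ, Finset.sum_range_zero] at hu
      have hu' : Real.exp 0.8 ≤ 2.2255410 := le_trans hu (by norm_num [Nat.factorial])
      have e : Real.exp 1.6 = Real.exp 0.8 ^ 2 := by rw [← Real.exp_nat_mul]; norm_num
      rw [e]
      nlinarith [Real.exp_pos (0.8 : ℝ)]
    rw [hFapp, w_node hb₀out hbout hc hf hlog5 hn]; simp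
  have hosc : ∃ t : ℝ, Real.log 2 ≤ |t| ∧ (F t).re < 0 := by
    refine ⟨0.86, ?_, ?_⟩
    · rw [abs_of_pos (by norm_num)]; linarith [Real.log_two_lt_d9]
    · rw [hFapp, w_f86 hb₀out hbin hbout hc hf]; simp
  /- ### the mutated statement at the witness -/
  have key : -(F 0).re ≤ (weilPolarTerm F + weilArchTerm F).re :=
    h (11 / 10) (by norm_num) F ⟨hFtest, hsupp⟩ hherm hdom hnodes hosc
  rw [hF0, Complex.one_re] at key
  /- ### the polar term: `Re = 2 ∫_{t>0} p`, `p(t) = f(t)(e^{-t/2} + e^{t/2})` -/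
  obtain ⟨p, hp⟩ : ∃ p : ℝ → ℝ, p = fun t => f t * (Real.exp (-(t / 2)) + Real.exp (t / 2)) := ⟨_, rfl⟩
  have hp_cont : Continuous p := by
    rw [hp]; exact hfs.continuous.mul (by fun_prop)
  have hp_int : Integrable p := by
    refine hp_cont.integrable_of_hasCompactSupport ?_
    rw [hp]; exact hfc.mul_right
  have hpolar : (weilPolarTerm F).re = 2 * ∫ t in Ioi (0 : ℝ), p t := by
    have hI := fun s : ℂ => integrable_weilIntegrand hFtest.1.continuous hFtest.2 s
    have e1 : weilPolarTerm F = ∫ t : ℝ, F t * (cexp ((0 - 1 / 2) * t) + cexp ((1 - 1 / 2) * t)) := by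
      unfold weilPolarTerm weilMellin
      rw [← integral_add (hI 0) (hI 1)]
      congr 1 with t
      ring
    have hpt : ∀ t : ℝ, F t * (cexp ((0 - 1 / 2) * t) + cexp ((1 - 1 / 2) * t)) = ((p t : ℝ) : ℂ) := by
      intro t
      have ea : cexp ((0 - 1 / 2) * (t : ℂ)) = ((Real.exp (-(t / 2)) : ℝ) : ℂ) := by
        rw [Complex.ofReal_exp]; congr 1; push_cast; ring
      have eb : cexp ((1 - 1 / 2) * (t : ℂ)) = ((Real.exp (t / 2) : ℝ) : ℂ) := by
        rw [Complex.ofReal_exp]; congr 1; push_cast; ring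
      rw [ea, eb, hFapp, hp]
      push_cast
      ring
    have habs : ∀ t : ℝ, p |t| = p t := by
      intro t
      rcases le_or_gt 0 t with ht | ht
      · rw [abs_of_nonneg ht]
      · rw [abs_of_neg ht, hp]
        simp only
        rw [hfeven, neg_div, neg_neg, add_comm]
    rw [e1]
    simp_rw [hpt]
    rw [integral_complex_ofReal, Complex.ofReal_re, ← integral_comp_abs]
    exact integral_congr_ae (Eventually.of_forall fun t => (habs t).symm)
  /- ### the archimedean term (Bombieri): `Re = -(log 4π + γ) - ∫_{t>0} q`, `q(t) = (e^{t/2} f(t) - 1)/sinh t` -/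
  obtain ⟨q, hq⟩ : ∃ q : ℝ → ℝ, q = fun t => (Real.exp (t / 2) * f t - 1) / Real.sinh t := ⟨_, rfl⟩
  have harch : (weilArchTerm F).re =
      -(Real.log (4 * Real.pi) + Real.eulerMascheroniConstant) - ∫ t in Ioi (0 : ℝ), q t := by
    rw [← weilArchTermBombieri_eq_weilArchTerm_holds hFtest, weilArchTermBombieri_eq, hF0]
    have hint_eq : ∀ t ∈ Ioi (0 : ℝ),
        ((Real.exp (t / 2) : ℂ) * (F t + F (-t)) - 2 * (1 : ℂ)) / (2 * Real.sinh t : ℂ) = ((q t : ℝ) : ℂ) := by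
      intro t ht
      have ht0 : 0 < t := ht
      have hs : (Real.sinh t : ℂ) ≠ 0 := by exact_mod_cast (Real.sinh_pos_iff.2 ht0).ne'
      have hs' : Real.sinh t ≠ 0 := (Real.sinh_pos_iff.2 ht0).ne'
      rw [heven t, hFapp, hq]
      push_cast
      field_simp
      ring
    rw [setIntegral_congr_fun measurableSet_Ioi hint_eq, integral_complex_ofReal]
    simp only [mul_one, Complex.sub_re, Complex.neg_re, Complex.add_re, Complex.ofReal_re]
  /- ### integrability of `q` on `(0, ∞)` (Bombieri's majorant) -/
  have hk : IsWeilTest (fun t => F t + F (-t)) :=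
    hFtest.add ⟨hFtest.1.comp contDiff_neg, hFtest.2.comp_homeomorph (Homeomorph.neg ℝ)⟩
  have hq_int : IntegrableOn q (Ioi 0) := by
    have hm := integrableOn_bombieriMajorant hk
    refine Integrable.mono' hm ?_ ?_
    · have hcont : ContinuousOn q (Ioi 0) := by
        rw [hq]
        refine ContinuousOn.div ?_ Real.continuous_sinh.continuousOn fun t ht =>
          (Real.sinh_pos_iff.2 (show 0 < t from ht)).ne'
        exact (((Real.continuous_exp.comp (continuous_id.div_const 2)).mul hfs.continuous).sub
          continuous_const).continuousOn
      exact hcont.aestronglyMeasurable measurableSet_Ioi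
    · refine (ae_restrict_iff' measurableSet_Ioi).2 (Eventually.of_forall fun t (ht : 0 < t) => ?_)
      have hs : 0 < Real.sinh t := Real.sinh_pos_iff.2 ht
      have e : (Real.exp (t / 2) : ℂ) * (F t + F (-t)) - (F 0 + F (-0)) =
          (((2 * (Real.exp (t / 2) * f t - 1)) : ℝ) : ℂ) := by
        rw [heven t, neg_zero, hF0, hFapp]
        push_cast
        ring
      show ‖q t‖ ≤ ‖(Real.exp (t / 2) : ℂ) * (F t + F (-t)) - (F 0 + F (-0))‖ / (2 * Real.sinh t)
      rw [e, Complex.norm_real, Real.norm_eq_abs, Real.norm_eq_abs, hq]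
      simp only
      rw [abs_div, abs_of_pos hs, abs_mul, abs_two, mul_div_mul_left _ _ (two_ne_zero)]
  /- ### the combined density `D = 2p - q` on `(0, ∞)` -/
  obtain ⟨D, hDdef⟩ : ∃ D : ℝ → ℝ, D = fun t => 2 * (f t * (Real.exp (-(t / 2)) + Real.exp (t / 2))) -
      (Real.exp (t / 2) * f t - 1) / Real.sinh t := ⟨_, rfl⟩
  have hD_eq : ∀ t, 0 < t → D t = f t * (2 * (Real.exp (t / 2) + (Real.exp (t / 2))⁻¹) -
      2 * Real.exp (t / 2) ^ 3 / (Real.exp (t / 2) ^ 4 - 1)) +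
        2 * Real.exp (t / 2) ^ 2 / (Real.exp (t / 2) ^ 4 - 1) := fun t ht => by
    rw [hDdef]
    exact dfun_eq (f t) t ht
  have hDpq : D = fun t => 2 * p t - q t := by
    rw [hDdef, hp, hq]
  have hp2 : IntegrableOn (fun t => 2 * p t) (Ioi 0) := (hp_int.const_mul 2).integrableOn
  have hD_int : IntegrableOn D (Ioi 0) := by
    rw [hDpq]
    exact hp2.sub hq_int
  have hcomb : (weilPolarTerm F + weilArchTerm F).re + 1 =
      1 - (Real.log (4 * Real.pi) + Real.eulerMascheroniConstant) + ∫ t in Ioi (0 : ℝ), D t := by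
    rw [Complex.add_re, hpolar, harch, hDpq, integral_sub hp2 hq_int, MeasureTheory.integral_const_mul]
    ring
  /- ### splitting at `T = 2.18`: 23 cells and a tail -/
  have hT : (0 : ℝ) ≤ 2.18 := by norm_num
  have hsplit : ∫ t in Ioi (0 : ℝ), D t = (∫ t in (0 : ℝ)..2.18, D t) + ∫ t in Ioi (2.18 : ℝ), D t := by
    rw [intervalIntegral.integral_of_le hT, ← setIntegral_union Ioc_disjoint_Ioi_same measurableSet_Ioi
      (hD_int.mono_set Ioc_subset_Ioi_self) (hD_int.mono_set (Ioi_subset_Ioi hT)), Ioc_union_Ioi_eq_Ioi hT]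
  obtain ⟨x, hx⟩ : ∃ x : ℕ → ℝ, x = fun i => ([(0 : ℝ), 0.28, 0.32, 0.36, 0.5, 0.64, 0.68, 0.7, 0.74, 0.86, 0.98, 1.02, 1.2, 1.4, 1.42, 1.48, 1.54, 1.56, 1.82, 2.1, 2.12, 2.14, 2.16, 2.18] : List ℝ).getD i 2.18 := ⟨_, rfl⟩
  obtain ⟨Mv, hM⟩ : ∃ Mv : ℕ → ℝ, Mv = fun i => ([(4.03928 : ℝ), 3.97114, 3.07231, 1.90855, 0.25749, 1.46073, 1.36310, 1.31826, -1.25283, -1.75979, 0.87370, 0.82900, 0.66250, 0.52514, -3.49353, -3.65955, 0.44943, 0.43970, 0.33280, 0.24866, -5.51903, -5.58250, 0.23377] : List ℝ).getD i 0 := ⟨_, rfl⟩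
  obtain ⟨hx0, hx23, hmono, hxnn⟩ := grid_facts hx
  have hint : ∀ i < 23, IntervalIntegrable D volume (x i) (x (i + 1)) := fun i hi =>
    (intervalIntegrable_iff_integrableOn_Ioc_of_le (hmono i hi)).2
      (hD_int.mono_set (Ioc_subset_Ioi_self.trans (Ioi_subset_Ioi (hxnn i hi))))
  have hbound := cells_dispatch hx hM hD_eq W_pos1 W_possh W_nonpos W_plateau
  have hcells : ∫ t in (0 : ℝ)..2.18, D t ≤ 1.39499 := by
    have h1 := integral_le_sum_cells hint hmono hbound
    rw [hx0, hx23] at h1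
    exact le_trans h1 (cells_sum hx hM)
  /- ### the tail `t ≥ 2.18` -/
  have htail : ∫ t in Ioi (2.18 : ℝ), D t ≤ 0.22902 := by
    have hTpos : (0 : ℝ) < 2.18 := by norm_num
    have hDtail : ∀ t ∈ Ioi (2.18 : ℝ), D t ≤ 2 / (1 - Real.exp (-(2 * 2.18))) * Real.exp (-t) := by
      intro t ht
      have ht' : (2.18 : ℝ) < t := ht
      have ht0 : 0 < t := by linarith
      have hft : f t = 0 := hzeroR t (by rw [abs_of_pos ht0]; exact ht'.le)
      rw [hD_eq t ht0, hft, zero_mul, zero_add]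
      exact tail_pointwise hTpos ht'.le
    have hmaj : IntegrableOn (fun t : ℝ => 2 / (1 - Real.exp (-(2 * 2.18))) * Real.exp (-t)) (Ioi 2.18) := by
      have h1 : IntegrableOn (fun t : ℝ => Real.exp (-t)) (Ioi 2.18) := by
        simpa using exp_neg_integrableOn_Ioi 2.18 zero_lt_one
      exact h1.const_mul _
    have hle := setIntegral_mono_on (hD_int.mono_set (Ioi_subset_Ioi hTpos.le)) hmaj measurableSet_Ioi hDtail
    rw [MeasureTheory.integral_const_mul, integral_exp_neg_Ioi] at hle
    exact le_trans hle tail_numeric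
  /- ### conclusion: `Re W_ar(F) + 1 ≤ 1 - 2.9849 + 1.39499 + 0.22902 < 0` -/
  have hL := budget_le
  have hneg : (weilPolarTerm F + weilArchTerm F).re + 1 < 0 := by
    rw [hcomb, hsplit]
    linarith [hcells, htail, hL]
  linarith [key, hneg]

end Summit.RiemannHypothesis.RiemannHypothesis.Theorems.SignConeOscillatory.Negative

end
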